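import Summits.NavierStokesRegularity.NavierStokesRegularity.Theorems.TargetDepletionLadderBoundedBiotSavartTools
import HarnessLib

/-!
# Crux `Target` (stmt-NavierStokesRegularity-1217), line `depletion_ladder`, stub S1 (registered class):
# the Biot–Savart representation MODULO CONSTANTS for BOUNDED fields

`--supports stmt-NavierStokesRegularity-1217` (seat leafhand-ns-poloidalwindowdoor-3 g0, cell decomp-ns; step
(P1) "representation" of the registered-class programme for `stub_depletionBelowHalf`, censuses
`S1-REGISTERED-CENSUS-leafhand-2-g1.md` / this seat's NOTES; tools in
`TargetDepletionLadderBoundedBiotSavartTools.lean`).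

The registered stub S1 quantifies over `C²` divergence-free fields `u : ℝ³ → ℝ³` that are merely
BOUNDED (`‖u‖ ≤ M`, no decay) with square-integrable vorticity. The landed depletion constants
(`…StrainCubeSharpDepletion`, `κ = (2+√3)/9`) live on square-integrable slices, where the tree's
representation theorem `biotSavart_curl_eq_self_of_lintegral_sq_lt_top` (`K₃ ∗ curl v = v` for
`v, curl v ∈ L²`) applies. For a bounded non-decaying field the representation is false as stated
(constants have zero curl), and what survives is the classical statement that the Helmholtz
projection of a bounded field is defined up to an additive constant:

* `sub_biotSavart_curl_eq_sub_biotSavart_curl`, `exists_eq_const_add_biotSavart_curl`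
  (`…_of_integrable_sq`) — for `v ∈ C²(ℝ³; ℝ³)` divergence free, `‖v‖ ≤ M` and `∫‖curl v‖² < ∞`, the
  difference `v − K₃ ∗ curl v` is a constant: `∃ c, ∀ x, v x = c + (K₃ ∗ curl v)(x)`.
  Proof: write the local Helmholtz identity (`eq_biotSavart_curl_suppCutoff_smul_add_of_norm_sub_le`)
  at `x` and at `x̄` with the SAME cutoff (centre the midpoint `ξ`, scale `ρₙ = n + 1 + ‖x − x̄‖`) and
  subtract. With `curl(φv) = φω + Dφ ⊗ v` the two near terms `(K₃ ∗ φₙω)(x)`, `(K₃ ∗ φₙω)(x̄)` tend to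
  `(K₃ ∗ ω)(x)`, `(K₃ ∗ ω)(x̄)` (`tendsto_integral_biotSavartKernel_suppCutoff_smul`), while the shell
  terms appear only through the kernel DIFFERENCES `K₃(x − y) − K₃(x̄ − y)`, `∂ⱼΓ(x − y) − ∂ⱼΓ(x̄ − y)`
  integrated against densities `≤ MBρₙ⁻¹` on a shell of volume `8|B₁|ρₙ³`
  (`norm_integral_kernel_sub_kernel_apply_shell_le`): they are `O(‖x − x̄‖ M ρₙ⁻¹) → 0`. Only
  `‖v‖ ≤ M` is used on the shell — no decay of `v`, no Liouville theorem, no Calderón–Zygmund bound.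

WHAT THIS GIVES THE PROGRAMME: with `c` in hand, `v − c = K₃ ∗ ω` splits at every scale `λ` as
`K₃^{<λ} ∗ ω + K₃^{≥λ} ∗ ω ∈ L² + L^∞` with norms `≲ λ‖ω‖₂` and `≲ λ^{-1/2}‖ω‖₂`, which is what the
cut-off energy identity needs to prove `∇v ∈ L²`, `‖∇v‖₂ = ‖curl v‖₂` in the registered class (P2).

HONEST LABEL: helper (step P1 of an L/XL programme: P2 = `∇v ∈ L²`; P3–P5 = the strain-cube chain
with cut-offs); closes no stub; no Navier–Stokes content; `Target`, S3 and NS regularity remain OPEN.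

References: A. J. Majda, A. L. Bertozzi, *Vorticity and Incompressible Flow* (CUP 2002), §2.4.1
Prop. 2.16, (2.92)–(2.95); P. G. Lemarié-Rieusset, *The Navier–Stokes problem in the 21st century*
(2016), §6.1 (Helmholtz/Leray projection of bounded fields modulo constants). [folklore]
-/

noncomputable section

-- the summit and its single sub-problem share the name (CONVENTIONS §1)
set_option linter.dupNamespace false

open MeasureTheory Set Function Filter Metric Real InnerProductSpace Topology
open scoped ENNReal NNReal RealInnerProductSpace Laplacian ContDiff
open Literature.Analysis.FluidPDE

namespace Summit.NavierStokesRegularity.NavierStokesRegularity.Theorems.DepletionLadder.BoundedBiotSavart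

/-! ### The representation modulo constants -/

section Main

variable {v : (EuclideanSpace ℝ (Fin 3)) → (EuclideanSpace ℝ (Fin 3))}

/-- **`v − K₃ ∗ curl v` is constant for bounded fields.** Let `v ∈ C²(ℝ³; ℝ³)` be divergence free,
BOUNDED (`‖v‖ ≤ M`), with `∫‖curl v‖² < ∞`. Then for all `x, x̄`:
`v(x) − (K₃ ∗ curl v)(x) = v(x̄) − (K₃ ∗ curl v)(x̄)`. Proof: the local Helmholtz identity at `x` and
at `x̄` with the common cutoff `suppCutoff ξ ρₙ`, `ξ` the midpoint, `ρₙ = n + 1 + ‖x − x̄‖`; the near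
terms converge to the Biot–Savart integrals (`tendsto_integral_biotSavartKernel_suppCutoff_smul`), the
shell terms enter through kernel differences and are `O(ρₙ⁻¹)`
(`norm_integral_kernel_sub_kernel_apply_shell_le` for `K₃` and for `∂Γ`). [folklore] -/
theorem sub_biotSavart_curl_eq_sub_biotSavart_curl (hv : ContDiff ℝ 2 v)
    (hdiv : VectorCalculus.IsDivFree v) {M : ℝ} (hM : ∀ y, ‖v y‖ ≤ M)
    (hω2 : ∫⁻ y, ‖curl v y‖ₑ ^ 2 < ⊤) (x x' : EuclideanSpace ℝ (Fin 3)) :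
    v x - biotSavart (curl v) x = v x' - biotSavart (curl v) x' := by
  obtain ⟨B, hB0, hB⟩ := exists_norm_fderiv_radialCutoff_le
  obtain ⟨A₁, hK₁⟩ := exists_isC1SingularKernel_biotSavartCLM
  obtain ⟨A₂, hK₂⟩ := exists_isC1SingularKernel_fderiv_newtonKernel
  have hM0 : 0 ≤ M := (norm_nonneg _).trans (hM 0)
  have hv1 : ContDiff ℝ 1 v := hv.of_le (by norm_num)
  have hvc : Continuous v := hv.continuous
  have hvd : Differentiable ℝ v := hv1.differentiable one_ne_zero
  set w : EuclideanSpace ℝ (Fin 3) → EuclideanSpace ℝ (Fin 3) := curl v with hwdef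
  have hωc : Continuous w := continuous_curl hv1
  have hω2i : Integrable fun y => ‖w y‖ ^ 2 := integrable_sq_norm_of_lintegral_lt_top hωc hω2
  set V₁ : ℝ := (volume (ball (0 : EuclideanSpace ℝ (Fin 3)) 1)).toReal with hV₁
  set ξ : EuclideanSpace ℝ (Fin 3) := mid x x' with hξ
  set d : ℝ := ‖x - x'‖ with hd
  have hd0 : 0 ≤ d := norm_nonneg _
  -- scales `ρ n = n + 1 + ‖x − x̄‖`
  set ρ : ℕ → ℝ := fun n => (n : ℝ) + 1 + d with hρdef
  have hρn : ∀ n : ℕ, (n : ℝ) + 1 ≤ ρ n := fun n => by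
    show (n : ℝ) + 1 ≤ (n : ℝ) + 1 + d; linarith
  have hρ0 : ∀ n, 0 < ρ n := fun n => lt_of_lt_of_le (by positivity) (hρn n)
  have hρd : ∀ n, d ≤ ρ n := fun n => by
    show d ≤ (n : ℝ) + 1 + d; linarith [(Nat.cast_nonneg n : (0 : ℝ) ≤ n)]
  have hxξ : ∀ n, ‖x - ξ‖ ≤ ρ n := fun n => by
    rw [hξ, norm_sub_mid]; linarith [hρd n]
  have hx'ξ : ∀ n, ‖x' - ξ‖ ≤ ρ n := fun n => by
    rw [hξ, norm_sub_mid']; linarith [hρd n]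
  -- the cutoffs
  set φ : ℕ → EuclideanSpace ℝ (Fin 3) → ℝ := fun n => suppCutoff ξ (ρ n) with hφdef
  have hφ1 : ∀ n, ContDiff ℝ 1 (φ n) := fun n => contDiff_suppCutoff ξ (ρ n) (n := 1)
  have hφd : ∀ n, Differentiable ℝ (φ n) := fun n => (hφ1 n).differentiable one_ne_zero
  have hφc : ∀ n, HasCompactSupport (φ n) := fun n => hasCompactSupport_suppCutoff ξ (hρ0 n)
  -- the densities of the shell terms
  set g : ℕ → EuclideanSpace ℝ (Fin 3) → EuclideanSpace ℝ (Fin 3) := fun n y =>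
    curlCLM ((fderiv ℝ (φ n) y).smulRight (v y)) with hgdef
  set f : ℕ → EuclideanSpace ℝ (Fin 3) → ℝ := fun n y => ⟪v y, gradient (φ n) y⟫ with hfdef
  -- the three sequences at a point `z`
  set main : ℕ → EuclideanSpace ℝ (Fin 3) → EuclideanSpace ℝ (Fin 3) := fun n z =>
    ∫ y, biotSavartKernel (z - y) (φ n y • w y) with hmain
  set rem : ℕ → EuclideanSpace ℝ (Fin 3) → EuclideanSpace ℝ (Fin 3) := fun n z =>
    ∫ y, biotSavartKernel (z - y) (g n y) with hrem
  set prs : ℕ → EuclideanSpace ℝ (Fin 3) → EuclideanSpace ℝ (Fin 3) := fun n z =>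
    ∑ j, (∫ y, fderiv ℝ newtonKernel (z - y) (EuclideanSpace.single (j : Fin 3) (1 : ℝ)) * f n y) •
      (EuclideanSpace.single (j : Fin 3) (1 : ℝ)) with hprs
  -- regularity of the densities
  have hsplit : ∀ n y, curl (fun y => φ n y • v y) y = φ n y • w y + g n y := fun n y =>
    curl_smul ((hφd n) y) (hvd y)
  have hs₁c : ∀ n, Continuous fun y => φ n y • w y := fun n => (hφ1 n).continuous.smul hωc
  have hs₁s : ∀ n, HasCompactSupport fun y => φ n y • w y := fun n => (hφc n).smul_right
  have hg_eq : ∀ n, g n = fun y => curl (fun y => φ n y • v y) y - φ n y • w y := fun n => by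
    funext y
    rw [hsplit n y, add_sub_cancel_left]
  have hgc : ∀ n, Continuous (g n) := fun n => by
    rw [hg_eq n]
    exact (continuous_curl ((hφ1 n).smul hv1)).sub (hs₁c n)
  have hgs : ∀ n, HasCompactSupport (g n) := fun n => by
    rw [hg_eq n]
    have hWs : HasCompactSupport ((φ n) • v) := (hφc n).smul_right
    exact (hasCompactSupport_curl hWs).sub (hs₁s n)
  have hfc' : ∀ n, Continuous (f n) := fun n =>
    Continuous.inner hvc (contDiff_gradient_suppCutoff_scale ξ (ρ n)).continuous
  have hfs : ∀ n, HasCompactSupport (f n) := fun n => by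
    refine (hasCompactSupport_gradient_suppCutoff_scale ξ (hρ0 n)).mono ?_
    intro y hy
    rw [mem_support] at hy ⊢
    intro h
    exact hy (show ⟪v y, gradient (φ n) y⟫ = 0 by rw [h, inner_zero_right])
  -- shell bounds on the densities: `‖g‖ ≤ ‖∇φ‖ (‖curlCLM‖ M)`, `‖f eⱼ‖ ≤ ‖∇φ‖ M`
  have hg_le : ∀ n y, ‖g n y‖ ≤ ‖fderiv ℝ (suppCutoff (mid x x') (ρ n)) y‖ * (‖curlCLM‖ * M) := by
    intro n y
    calc ‖g n y‖ ≤ ‖curlCLM‖ * ‖(fderiv ℝ (φ n) y).smulRight (v y)‖ := ContinuousLinearMap.le_opNorm _ _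
      _ = ‖curlCLM‖ * (‖fderiv ℝ (φ n) y‖ * ‖v y‖) := by
          rw [ContinuousLinearMap.norm_smulRight_apply]
      _ ≤ ‖curlCLM‖ * (‖fderiv ℝ (φ n) y‖ * M) := by gcongr; exact hM y
      _ = ‖fderiv ℝ (suppCutoff (mid x x') (ρ n)) y‖ * (‖curlCLM‖ * M) := by rw [hφdef]; ring
  have he1 : ∀ j : Fin 3, ‖(EuclideanSpace.single (j : Fin 3) (1 : ℝ))‖ = 1 := fun j => by simp
  have hf_le : ∀ n (j : Fin 3) y, ‖f n y • (EuclideanSpace.single (j : Fin 3) (1 : ℝ))‖ ≤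
      ‖fderiv ℝ (suppCutoff (mid x x') (ρ n)) y‖ * M := by
    intro n j y
    rw [norm_smul, he1 j, mul_one, Real.norm_eq_abs]
    calc |f n y| = |⟪v y, gradient (φ n) y⟫| := rfl
      _ ≤ ‖v y‖ * ‖gradient (φ n) y‖ := abs_real_inner_le_norm _ _
      _ = ‖v y‖ * ‖fderiv ℝ (φ n) y‖ := by rw [gradient, LinearIsometryEquiv.norm_map]
      _ ≤ M * ‖fderiv ℝ (φ n) y‖ := mul_le_mul_of_nonneg_right (hM y) (norm_nonneg _)
      _ = ‖fderiv ℝ (suppCutoff (mid x x') (ρ n)) y‖ * M := by rw [hφdef]; ring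
  -- (1) the identity at every scale, at `x` and at `x̄`
  have hid : ∀ n (z : EuclideanSpace ℝ (Fin 3)), ‖z - ξ‖ ≤ ρ n →
      v z = main n z + rem n z + prs n z := by
    intro n z hz
    have h := eq_biotSavart_curl_suppCutoff_smul_add_of_norm_sub_le hv hdiv (hρ0 n) ξ hz
    have I₁ := integrable_biotSavartKernel_sub_apply_of_hasCompactSupport (hs₁c n) (hs₁s n) z
    have I₂ := integrable_biotSavartKernel_sub_apply_of_hasCompactSupport (hgc n) (hgs n) z
    have hBS : biotSavart (curl fun y => φ n y • v y) z = main n z + rem n z := by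
      rw [biotSavart, hmain, hrem, ← integral_add I₁ I₂]
      refine integral_congr_ae (Eventually.of_forall fun y => ?_)
      show biotSavartKernel (z - y) (curl (fun y => φ n y • v y) y) =
        biotSavartKernel (z - y) (φ n y • w y) + biotSavartKernel (z - y) (g n y)
      rw [← biotSavartCLM_apply, ← biotSavartCLM_apply, ← biotSavartCLM_apply, hsplit, map_add]
    rw [h, hBS]
  -- (2) the shell terms differ by `O(ρ⁻¹)`
  set C₁ : ℝ := 64 * A₁ * B * (‖curlCLM‖ * M) * V₁ * d with hC₁
  set C₂ : ℝ := 64 * A₂ * B * M * V₁ * d with hC₂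
  have hrem_le : ∀ n, ‖rem n x - rem n x'‖ ≤ C₁ * (ρ n)⁻¹ := by
    intro n
    have I := fun z => integrable_biotSavartKernel_sub_apply_of_hasCompactSupport (hgc n) (hgs n) z
    have hdiff : rem n x - rem n x' = ∫ y, (biotSavartCLM (x - y) - biotSavartCLM (x' - y)) (g n y) := by
      rw [hrem]
      show (∫ y, biotSavartKernel (x - y) (g n y)) - ∫ y, biotSavartKernel (x' - y) (g n y) = _
      rw [← integral_sub (I x) (I x')]
      refine integral_congr_ae (Eventually.of_forall fun y => ?_)
      show biotSavartKernel (x - y) (g n y) - biotSavartKernel (x' - y) (g n y) =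
        (biotSavartCLM (x - y) - biotSavartCLM (x' - y)) (g n y)
      rw [_root_.sub_apply, biotSavartCLM_apply, biotSavartCLM_apply]
    rw [hdiff]
    refine (norm_integral_kernel_sub_kernel_apply_shell_le hK₁ hB hB0 (hρ0 n) (hρd n)
      (by positivity) (hg_le n)).trans (le_of_eq ?_)
    rw [hC₁]
  have hprs_le : ∀ n, ‖prs n x - prs n x'‖ ≤ 3 * C₂ * (ρ n)⁻¹ := by
    intro n
    -- each coefficient is a kernel integral against `f eⱼ`
    have hcoef : ∀ (j : Fin 3) (z : EuclideanSpace ℝ (Fin 3)),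
        (∫ y, fderiv ℝ newtonKernel (z - y) (EuclideanSpace.single (j : Fin 3) (1 : ℝ)) * f n y) =
          ∫ y, fderiv ℝ newtonKernel (z - y) (f n y • EuclideanSpace.single (j : Fin 3) (1 : ℝ)) := by
      intro j z
      refine integral_congr_ae (Eventually.of_forall fun y => ?_)
      show fderiv ℝ newtonKernel (z - y) (EuclideanSpace.single (j : Fin 3) (1 : ℝ)) * f n y =
        fderiv ℝ newtonKernel (z - y) (f n y • EuclideanSpace.single (j : Fin 3) (1 : ℝ))
      rw [map_smul, smul_eq_mul, mul_comm]
    have Ij : ∀ (j : Fin 3) (z : EuclideanSpace ℝ (Fin 3)), Integrable fun y =>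
        fderiv ℝ newtonKernel (z - y) (f n y • EuclideanSpace.single (j : Fin 3) (1 : ℝ)) := by
      intro j z
      have hc : Continuous fun y => f n y • EuclideanSpace.single (j : Fin 3) (1 : ℝ) :=
        (hfc' n).smul continuous_const
      have hs : HasCompactSupport fun y => f n y • EuclideanSpace.single (j : Fin 3) (1 : ℝ) :=
        (hfs n).smul_right
      exact integrable_kernel_sub_apply hK₂ hc hs z
    have hj : ∀ j : Fin 3,
        |(∫ y, fderiv ℝ newtonKernel (x - y) (EuclideanSpace.single (j : Fin 3) (1 : ℝ)) * f n y) -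
          ∫ y, fderiv ℝ newtonKernel (x' - y) (EuclideanSpace.single (j : Fin 3) (1 : ℝ)) * f n y| ≤
          C₂ * (ρ n)⁻¹ := by
      intro j
      rw [hcoef j x, hcoef j x', ← integral_sub (Ij j x) (Ij j x'), ← Real.norm_eq_abs]
      have heq : (fun y => fderiv ℝ newtonKernel (x - y) (f n y • EuclideanSpace.single (j : Fin 3) (1 : ℝ)) -
          fderiv ℝ newtonKernel (x' - y) (f n y • EuclideanSpace.single (j : Fin 3) (1 : ℝ))) =
          fun y => ((fun z => fderiv ℝ newtonKernel z) (x - y) - (fun z => fderiv ℝ newtonKernel z) (x' - y))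
            (f n y • EuclideanSpace.single (j : Fin 3) (1 : ℝ)) := by
        funext y
        rw [_root_.sub_apply]
      rw [heq]
      refine (norm_integral_kernel_sub_kernel_apply_shell_le hK₂ hB hB0 (hρ0 n) (hρd n) hM0
        (hf_le n j)).trans (le_of_eq ?_)
      rw [hC₂]
    have hsub : prs n x - prs n x' = ∑ j,
        ((∫ y, fderiv ℝ newtonKernel (x - y) (EuclideanSpace.single (j : Fin 3) (1 : ℝ)) * f n y) -
          ∫ y, fderiv ℝ newtonKernel (x' - y) (EuclideanSpace.single (j : Fin 3) (1 : ℝ)) * f n y) •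
          (EuclideanSpace.single (j : Fin 3) (1 : ℝ)) := by
      rw [hprs]
      show (∑ j, (∫ y, fderiv ℝ newtonKernel (x - y) (EuclideanSpace.single (j : Fin 3) (1 : ℝ)) * f n y) •
          (EuclideanSpace.single (j : Fin 3) (1 : ℝ))) -
        ∑ j, (∫ y, fderiv ℝ newtonKernel (x' - y) (EuclideanSpace.single (j : Fin 3) (1 : ℝ)) * f n y) •
          (EuclideanSpace.single (j : Fin 3) (1 : ℝ)) = _
      rw [← Finset.sum_sub_distrib]
      refine Finset.sum_congr rfl fun j _ => ?_
      rw [sub_smul]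
    rw [hsub]
    calc ‖∑ j, ((∫ y, fderiv ℝ newtonKernel (x - y) (EuclideanSpace.single (j : Fin 3) (1 : ℝ)) * f n y) -
          ∫ y, fderiv ℝ newtonKernel (x' - y) (EuclideanSpace.single (j : Fin 3) (1 : ℝ)) * f n y) •
          (EuclideanSpace.single (j : Fin 3) (1 : ℝ))‖
        ≤ ∑ j, ‖((∫ y, fderiv ℝ newtonKernel (x - y) (EuclideanSpace.single (j : Fin 3) (1 : ℝ)) * f n y) -
          ∫ y, fderiv ℝ newtonKernel (x' - y) (EuclideanSpace.single (j : Fin 3) (1 : ℝ)) * f n y) •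
          (EuclideanSpace.single (j : Fin 3) (1 : ℝ))‖ := norm_sum_le _ _
      _ ≤ ∑ _j : Fin 3, C₂ * (ρ n)⁻¹ := by
          refine Finset.sum_le_sum fun j _ => ?_
          rw [norm_smul, he1 j, mul_one, Real.norm_eq_abs]
          exact hj j
      _ = 3 * C₂ * (ρ n)⁻¹ := by
          rw [Finset.sum_const, Finset.card_univ, Fintype.card_fin]
          simp
          ring
  -- (3) the two differences tend to `0`
  have hρinv : Tendsto (fun n => (ρ n)⁻¹) atTop (𝓝 0) := by
    have h1 : Tendsto (fun n : ℕ => (n : ℝ) + 1) atTop atTop :=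
      tendsto_atTop_add_const_right atTop 1 tendsto_natCast_atTop_atTop
    have h2 : Tendsto ρ atTop atTop := by
      refine tendsto_atTop_mono (fun n => hρn n) h1
    exact h2.inv_tendsto_atTop
  have hD0 : Tendsto (fun n => (rem n x - rem n x') + (prs n x - prs n x')) atTop (𝓝 0) := by
    have h1 : Tendsto (fun n => rem n x - rem n x') atTop (𝓝 0) := by
      refine squeeze_zero_norm hrem_le ?_
      simpa using hρinv.const_mul C₁
    have h2 : Tendsto (fun n => prs n x - prs n x') atTop (𝓝 0) := by
      refine squeeze_zero_norm hprs_le ?_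
      simpa using hρinv.const_mul (3 * C₂)
    simpa using h1.add h2
  -- (4) the near terms converge to the Biot–Savart integrals
  have hmx : Tendsto (fun n => main n x) atTop (𝓝 (biotSavart w x)) :=
    tendsto_integral_biotSavartKernel_suppCutoff_smul hωc hω2i ξ x hρ0 hρn
  have hmx' : Tendsto (fun n => main n x') atTop (𝓝 (biotSavart w x')) :=
    tendsto_integral_biotSavartKernel_suppCutoff_smul hωc hω2i ξ x' hρ0 hρn
  -- (5) conclude
  have hkey : ∀ n, (v x - main n x) - (v x' - main n x') =
      (rem n x - rem n x') + (prs n x - prs n x') := by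
    intro n
    have h1 := hid n x (hxξ n)
    have h2 := hid n x' (hx'ξ n)
    rw [h1, h2]
    abel
  have hlim : Tendsto (fun n => (v x - main n x) - (v x' - main n x')) atTop
      (𝓝 ((v x - biotSavart w x) - (v x' - biotSavart w x'))) :=
    (tendsto_const_nhds.sub hmx).sub (tendsto_const_nhds.sub hmx')
  have hlim0 : Tendsto (fun n => (v x - main n x) - (v x' - main n x')) atTop (𝓝 0) :=
    hD0.congr fun n => (hkey n).symm
  have h := tendsto_nhds_unique hlim hlim0
  exact sub_eq_zero.1 h

/-- **The Biot–Savart representation modulo constants for bounded fields.** For `v ∈ C²(ℝ³; ℝ³)`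
divergence free with `‖v‖ ≤ M` and `∫‖curl v‖² < ∞` there is a constant vector `c` with
`v = c + K₃ ∗ curl v` everywhere. (For square-integrable `v` the constant is `0` by the tree's
`biotSavart_curl_eq_self_of_lintegral_sq_lt_top`; here no decay of `v` is assumed.) [folklore] -/
theorem exists_eq_const_add_biotSavart_curl (hv : ContDiff ℝ 2 v)
    (hdiv : VectorCalculus.IsDivFree v) {M : ℝ} (hM : ∀ y, ‖v y‖ ≤ M)
    (hω2 : ∫⁻ y, ‖curl v y‖ₑ ^ 2 < ⊤) :
    ∃ c : EuclideanSpace ℝ (Fin 3), ∀ x, v x = c + biotSavart (curl v) x := by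
  refine ⟨v 0 - biotSavart (curl v) 0, fun x => ?_⟩
  have h := sub_biotSavart_curl_eq_sub_biotSavart_curl hv hdiv hM hω2 x 0
  rw [← h, sub_add_cancel]

/-- The same statement with the square-integrability hypothesis as Bochner integrability of
`‖curl v‖²`. [folklore] -/
theorem exists_eq_const_add_biotSavart_curl_of_integrable_sq (hv : ContDiff ℝ 2 v)
    (hdiv : VectorCalculus.IsDivFree v) {M : ℝ} (hM : ∀ y, ‖v y‖ ≤ M)
    (hω2 : Integrable fun y => ‖curl v y‖ ^ 2) :
    ∃ c : EuclideanSpace ℝ (Fin 3), ∀ x, v x = c + biotSavart (curl v) x := by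
  refine exists_eq_const_add_biotSavart_curl hv hdiv hM ?_
  have h := hω2.hasFiniteIntegral
  rw [hasFiniteIntegral_iff_enorm] at h
  refine lt_of_le_of_lt (le_of_eq ?_) h
  refine lintegral_congr fun y => ?_
  rw [Real.enorm_eq_ofReal (sq_nonneg _), ← ofReal_norm, ENNReal.ofReal_pow (norm_nonneg _)]

end Main

end Summit.NavierStokesRegularity.NavierStokesRegularity.Theorems.DepletionLadder.BoundedBiotSavart

end
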